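import Summits.BirchSwinnertonDyer.BirchSwinnertonDyer.Theses.PrintCf2RubinValueTwo
import Summits.BirchSwinnertonDyer.BirchSwinnertonDyer.Theorems.PrintCf2SplitBadTwoRestrictedControlOfLevelCounts
import Summits.BirchSwinnertonDyer.BirchSwinnertonDyer.Theorems.PrintCf2SplitBadTwoRestrictedControlHolds
import HarnessLib

/-!
# Route C `PrintCf2RubinValueTwo`, item `RestrictedSelmerControlAtTwo` (stmt-BirchSwinnertonDyer-23723, S3c) — BY-NAME CLOSERS
# from the ONE displayed hypothesis of the S3c board: (F3), resp. the level-`N` index count `hcounts`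

Cell `bsd-print-cf2`, width seat `bsd-line-cf2c-w2` g0 (prover-bsd-line-cf2c-w2-g0-0); `--supports stmt-BirchSwinnertonDyer-23723`.
HONEST FRAMING: each theorem is an IMPLICATION whose conclusion is the route-C item `RestrictedSelmerControlAtTwo` BY NAME (the literal
route decl, not its unfolded text); the hypothesis is NOT proved here. When `hcounts` (or (F3)) becomes a tree theorem, the unconditional
closer `restrictedSelmerControlAtTwo_holds` is one more line in this file (append protocol) and closes the item `--workitem`. BSD is not
proved by any of this; no summit statement is proved by this seat. THEOREMS ONLY (no definition, no named fact, no `sorry`).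

HOW. LEAD cf2-p1 g13's sixteenth cut (p679366, `RestrictedSelmerPair.restrictedControl_two_of_F3` /
`RestrictedSelmerPair.restrictedControl_two_of_levelCounts`, fact-free: the three Poitou–Tate / `cd₂ ≤ 2` inputs are the tree theorems
`PoitouTateReduction.poitouTate_sha_tateDual_holds`, `…poitouTate_selmerStructure_duality_holds`, `fieldCdLE_two_of_numberField_holds`;
(F1) := -w6 g3 `hF1_holds`, (H2) := -w2 g11 `CMPrimes.hH2_holds`) proves the v10.3 stub statement `stub_restrictedControl_two`; the route-C
item is that statement VERBATIM (planner g17 certificate `routeC/cert.lean`, planner g18 `s3c/FactDischarge.lean`), so `unfold` + `exact`.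
Hypothesis texts below are copied byte-for-byte from p679366.

References: A. Agboola, Compositio 143 (2007) §3 Prop. 3.2, §6 Prop. 6.10–6.11, §8 Prop. 8.1 [Agboola2007]; R. Greenberg, LNM 1716 (1999)
§3 Lemmas 3.1–3.3, §4 Lemma 4.2, §5 Prop. 5.8 [GreenbergLNM1716]; J. S. Milne, ADT (2006) I Thm. 4.10 [MilneADT2006];
B. Mazur–K. Rubin, Mem. AMS 799 (2004) Def. 2.1.1 [MazurRubin2004].
-/

noncomputable section

open scoped Classical

set_option linter.dupNamespace false
set_option autoImplicit false

open NumberField IsDedekindDomain Field WeierstrassCurve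
open Literature.NumberTheory.EllipticCurves Literature.NumberTheory.EllipticCurves.GreenbergSelmer
open Literature.NumberTheory.EllipticCurves.Agboola2007
open Literature.NumberTheory.EllipticCurves.IwasawaAlgebra
open Literature.NumberTheory.EllipticCurves.IwasawaDual
open Literature.NumberTheory.EllipticCurves.ResKernel
open Literature.NumberTheory.GaloisRepresentations
open Literature.NumberTheory.GaloisRepresentations.DiscreteGaloisModule (SelmerStructure)
open Literature.NumberTheory.GaloisCohomology
open Literature.NumberTheory.EllipticCurves.Castella2018.AcSelmer
open scoped ContRepresentation
open Summit.BirchSwinnertonDyer.Rank1Residual.X11b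
open Summit.BirchSwinnertonDyer.Rank1Residual.X11b.Levels
open Summit.BirchSwinnertonDyer.BirchSwinnertonDyer.Theorems.PrintCf2.AdditiveAtSeven
open Summit.BirchSwinnertonDyer.BirchSwinnertonDyer.Theorems.GoldfeldGoodTwists
open Summit.BirchSwinnertonDyer.BirchSwinnertonDyer.Theorems.PrintCf2

namespace Summit.BirchSwinnertonDyer.BirchSwinnertonDyer.Theorems.PrintCf2.RubinValueTwoControl

/-- **Route-C item `RestrictedSelmerControlAtTwo` (S3c) ⟸ (F3), BY NAME and fact-free**: the literal route decl from the (F3) display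
«`v₂ #loc_v(𝔖_{v̄}(K, W*)) = ℓ + e₃([d]₂)`» (hypothesis VERBATIM from LEAD g13's cut 16(a) `RestrictedSelmerPair.restrictedControl_two_of_F3`).
[cite: Agboola2007, §3 Prop. 3.2, §6 Prop. 6.10–6.11, §8 Prop. 8.1] [cite: GreenbergLNM1716, §3 Lemmas 3.1–3.3, §4 Lemma 4.2] [cite: MilneADT2006, I Thm. 4.10] -/
theorem restrictedSelmerControlAtTwo_of_F3
    (hF3 : ∃ e₃ : ℤ → ℤ → ℤ, ∀ (d : ℤ), d ≠ 0 → Squarefree d → d % 4 ≠ 1 →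
      ∀ (W : WeierstrassCurve ℚ) [W.IsElliptic] [W.IsGloballyMinimal] (C : WeierstrassCurve.VariableChange ℚ),
        C • W = cm7.quadraticTwist (d : ℚ) → W.analyticRank = 1 →
      ∀ (K : Type) [Field K] [NumberField K], IsImaginaryQuadratic K →
      ∀ (v vbar : HeightOneSpectrum (𝓞 K)),
        ((2 : ℕ) : 𝓞 K) ∈ v.asIdeal → ((2 : ℕ) : 𝓞 K) ∈ vbar.asIdeal → vbar ≠ v →
      ∀ (π : (W.baseChange K).endRing), (π : AddMonoid.End (W.baseChange K).geomPoints) * π = π - 2 →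
      ∀ (r : ℤ_[2]), r * r = r - 2 →
        (∀ τ ∈ GreenbergSelmer.inertia v, ∀ x : ↥((W.baseChange K).endEigenPrimaryTorsion 2 π r), τ • x = x ∨ τ • x = -x) →
      ∀ (P : W.toAffine.Point) (c₀ : ℕ) (ℓ : ℤ),
        ¬ IsOfFinAddOrder P →
        (∀ R : W.toAffine.Point, ∃ (k : ℤ) (T : W.toAffine.Point), IsOfFinAddOrder T ∧ R = k • P + T) →
        c₀ ≠ 0 → (W.baseChange ℚ_[2]).IsInReductionKernel (c₀ • W.toPadicPoint 2 P) →
        ‖(W.baseChange ℚ_[2]).padicLogPoint (c₀ • W.toPadicPoint 2 P) / (c₀ : ℚ_[2])‖ = (2 : ℝ) ^ (-ℓ) →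
      Finite (restrictedSelmerBase ↥((W.baseChange K).endEigenPrimaryTorsion 2 π r) 2 vbar) →
        (padicValNat 2 (Nat.card ((resOfLe ↥((W.baseChange K).endEigenPrimaryTorsion 2 π r) (inf_le_left : ⊤ ⊓ decomp v ≤ ⊤)).comp
          (restrictedSelmerBase ↥((W.baseChange K).endEigenPrimaryTorsion 2 π r) 2 vbar).subtype).range) : ℤ) = ℓ + e₃ (d % 2) ((d / (2 - d % 2)) % 8)) :
    Summit.BirchSwinnertonDyer.BirchSwinnertonDyer.Theses.PrintCf2RubinValueTwo.RestrictedSelmerControlAtTwo := by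
  unfold Summit.BirchSwinnertonDyer.BirchSwinnertonDyer.Theses.PrintCf2RubinValueTwo.RestrictedSelmerControlAtTwo
  exact RestrictedSelmerPair.restrictedControl_two_of_F3 hF3

/-- **Route-C item `RestrictedSelmerControlAtTwo` (S3c) ⟸ the level-`N` index count `hcounts`, BY NAME and fact-free**: the literal route
decl from the one displayed statement the (F3) seats target — for every CM projector `e` and all large `N`, a level shadow `eN` and, for every
OPTION A‴ torsion structure `𝓕` on `E[2^N]`, `v₂ [H¹_{𝓕[v ↦ ⊤]}(K, E[2^N]) : H¹_𝓕(K, E[2^N])] = ℓ + e₃([d]₂)` (hypothesis VERBATIM from LEAD g13's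
cut 16(b) `RestrictedSelmerPair.restrictedControl_two_of_levelCounts`, itself -w5 g3's `hF3_of_levelCounts` p678471).
[cite: GreenbergLNM1716, §5 proof of Prop. 5.8] [cite: Agboola2007, §6 Prop. 6.10–6.11] [cite: MazurRubin2004, Def. 2.1.1] -/
theorem restrictedSelmerControlAtTwo_of_levelCounts
    (hcounts : ∃ e₃ : ℤ → ℤ → ℤ, ∀ (d : ℤ), d ≠ 0 → Squarefree d → d % 4 ≠ 1 →
      ∀ (W : WeierstrassCurve ℚ) [W.IsElliptic] [W.IsGloballyMinimal] (C : WeierstrassCurve.VariableChange ℚ),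
        C • W = cm7.quadraticTwist (d : ℚ) → W.analyticRank = 1 →
      ∀ (K : Type) [Field K] [NumberField K], IsImaginaryQuadratic K →
      ∀ (v vbar : HeightOneSpectrum (𝓞 K)),
        ((2 : ℕ) : 𝓞 K) ∈ v.asIdeal → ((2 : ℕ) : 𝓞 K) ∈ vbar.asIdeal → vbar ≠ v →
      ∀ (π : (W.baseChange K).endRing), (π : AddMonoid.End (W.baseChange K).geomPoints) * π = π - 2 →
      ∀ (r : ℤ_[2]), r * r = r - 2 →
        (∀ τ ∈ GreenbergSelmer.inertia v, ∀ x : ↥((W.baseChange K).endEigenPrimaryTorsion 2 π r), τ • x = x ∨ τ • x = -x) →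
      ∀ (P : W.toAffine.Point) (c₀ : ℕ) (ℓ : ℤ),
        ¬ IsOfFinAddOrder P →
        (∀ R : W.toAffine.Point, ∃ (k : ℤ) (T : W.toAffine.Point), IsOfFinAddOrder T ∧ R = k • P + T) →
        c₀ ≠ 0 → (W.baseChange ℚ_[2]).IsInReductionKernel (c₀ • W.toPadicPoint 2 P) →
        ‖(W.baseChange ℚ_[2]).padicLogPoint (c₀ • W.toPadicPoint 2 P) / (c₀ : ℚ_[2])‖ = (2 : ℝ) ^ (-ℓ) →
      Finite (restrictedSelmerBase ↥((W.baseChange K).endEigenPrimaryTorsion 2 π r) 2 vbar) →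
      ∀ (e : (W.baseChange K).geomPrimaryTorsion 2 →+ ↥((W.baseChange K).endEigenPrimaryTorsion 2 π r)),
        (∀ x : ↥((W.baseChange K).endEigenPrimaryTorsion 2 π r), e x = x) →
        (∀ x ∈ (W.baseChange K).endEigenPrimaryTorsion 2 π (1 - r), e x = 0) →
        (∀ (σ : absoluteGaloisGroup K) (x : (W.baseChange K).geomPrimaryTorsion 2), e (σ • x) = σ • e x) →
      ∃ N₁ : ℕ, ∀ N : ℕ, N₁ ≤ N →
        ∃ eN : ((W.baseChange K).torsionGaloisModule ((2 ^ N : ℕ) : ℤ)).toContRepresentation →ⁱL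
            ((W.baseChange K).torsionGaloisModule ((2 ^ N : ℕ) : ℤ)).toContRepresentation,
          (∀ y, primaryInclusion (W.baseChange K) 2 N (eN y) =
            (e (primaryInclusion (W.baseChange K) 2 N y) : (W.baseChange K).geomPrimaryTorsion 2)) ∧
          ∀ 𝓕 : SelmerStructure ((W.baseChange K).torsionGaloisModule ((2 ^ N : ℕ) : ℤ)),
            (∀ w : InfinitePlace K, 𝓕 (Sum.inl w) = ⊤) →
            (∀ w : HeightOneSpectrum (𝓞 K), w ≠ v →
              𝓕 (Sum.inr w) = (galoisCohomology.map ((primaryInclusion (W.baseChange K) 2 N).restrictField (w.adicCompletion K)) 1).ker) →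
            𝓕 (Sum.inr v) = ((galoisCohomology.map ((primaryInclusion (W.baseChange K) 2 N).restrictField (v.adicCompletion K)) 1).ker).comap
              (galoisCohomology.map (eN.restrictField (v.adicCompletion K)) 1) →
            (padicValNat 2 (𝓕.selmerGroup.relIndex (SelmerStructure.selmerGroup (Function.update 𝓕 (Sum.inr v : Place K) ⊤))) : ℤ) =
              ℓ + e₃ (d % 2) ((d / (2 - d % 2)) % 8)) :
    Summit.BirchSwinnertonDyer.BirchSwinnertonDyer.Theses.PrintCf2RubinValueTwo.RestrictedSelmerControlAtTwo := by
  unfold Summit.BirchSwinnertonDyer.BirchSwinnertonDyer.Theses.PrintCf2RubinValueTwo.RestrictedSelmerControlAtTwo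
  exact RestrictedSelmerPair.restrictedControl_two_of_levelCounts hcounts

/-- **ROUTE-C ITEM `RestrictedSelmerControlAtTwo` (stmt-BirchSwinnertonDyer-23723, S3c) — CLOSED BY NAME, UNCONDITIONALLY** (APPENDED 2026-08-29):
the literal route decl, from -w8 g3's `SelmerLocImage.restrictedControl_two_holds` (= S3c VERBATIM, fact-free: hcounts ⟸ (PI) -w6 g4
`LocalPointImage.hPI_holds` ∧ (PIN) -w8 g3 `hPIN_holds` ∧ (ShaFin) -w6 g4 `CMPrimes.finite_sha_two_primary_baseChange_of_frame`, then -w5 g3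
`hF3_of_levelCounts`, LEAD cf2-p1 cuts 15 and 16 `restrictedControl_two_of_F3_H2` with (F1) -w6 g3 `hF1_holds`, (H2) -w2 g11 `CMPrimes.hH2_holds`,
and the three Poitou–Tate and `cd₂` inputs as tree theorems `poitouTate_sha_tateDual_holds`, `poitouTate_selmerStructure_duality_holds`,
`fieldCdLE_two_of_numberField_holds`). No hypothesis; axioms standard. This is booking rule (e): the v10.x stub statement IS the route-C item.
BSD is not proved by this: the item is ONE of the route's five cruxes (S3a 23720, S2′ 23721, S3b′ 23722 and the residual 23724 stay open).
[cite: Agboola2007, §3 Prop. 3.2, §5, §6 Prop. 6.10–6.11, §8 Prop. 8.1] [cite: GreenbergLNM1716, §3 Lemmas 3.1–3.3, §4 Lemma 4.2, §5 Prop. 5.8]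
[cite: MilneADT2006, I Thm. 4.10] [cite: MazurRubin2004, Def. 2.1.1] -/
theorem restrictedSelmerControlAtTwo_holds :
    Summit.BirchSwinnertonDyer.BirchSwinnertonDyer.Theses.PrintCf2RubinValueTwo.RestrictedSelmerControlAtTwo := by
  unfold Summit.BirchSwinnertonDyer.BirchSwinnertonDyer.Theses.PrintCf2RubinValueTwo.RestrictedSelmerControlAtTwo
  exact SelmerLocImage.restrictedControl_two_holds

end Summit.BirchSwinnertonDyer.BirchSwinnertonDyer.Theorems.PrintCf2.RubinValueTwoControl

end
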